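import Summits.BirchSwinnertonDyer.BirchSwinnertonDyer.Theorems.ByReductionTypeAtTwoTowerDoorsRankZero
import Summits.BirchSwinnertonDyer.BirchSwinnertonDyer.Theorems.TwoAdicConverseLambdaHalfTowerDoor
import HarnessLib

/-!
# Route `TwoAdicConverse` (S3) × K4 TOWER road — the `λ`-half TOWER doors (item `OrdLambdaHalfAtTwo`, 19556) WITHOUT `h414`
# on the locus where `Sel_{2^∞}(E/ℚ)` is finite (the rank-`0` 2-CONVERSE's own hypothesis): NO print replaces Greenberg 4.14@2

Cell `bsd-2adic`, seat `bsd-2adic-tower-1` (GEN 26), `--supports stmt-BirchSwinnertonDyer-19271` (helper; the doors compose the K4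
TOWER road's `KatoHalfPinch.le_lambda_of_towerGap_of_towerRank_of_finiteSelmer` with conv-1x's uniform `λ`-half door). THEOREMS ONLY
(no definition, no named fact, no `sorry`); closes nothing by itself; no door re-keyed (D-0152); BSD is not proved by any of this.

conv-1x's `TwoAdicTwistConverse.lambdaHalfAtTwo_of_towerGap_of_towerRank` / `…_of_layerSelmer` / `…_of_abbesUllmo` (file
`TwoAdicConverseLambdaHalfTowerDoor`, and the ≈150 S3 class displays `TwoAdicConverseLambdaHalfTower*` / `…GoodTwistsAnchoredTower*`)
carry PRINT {`hmod`, `h414`} (+ `hAU` on the irreducible block). On the locus where `Sel_{2^∞}(E/ℚ)` is FINITE — which is the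
HYPOTHESIS of the rank-`0` 2-converse (`corank_{ℤ₂} Sel_{2^∞}(E/ℚ) = 0 ⇒ r_an = 0`, item 19218) — the binder `h414` is a KERNEL
theorem (`GreenbergFiniteSub.forall_finite_eq_bot_of_goodOrd_of_noPTorsion`: `(Sel_∞)_γ = 0` ⇒ `X[T] = 0` ⇒ Nakayama), so:

* `lambdaHalfAtTwo_of_towerGap_of_towerRank_of_finiteSelmer` / `…_of_layerSelmer_of_finiteSelmer` — PRINT {`hmod`} + DISPLAYED
  `hper₀` + kernel {`GoodOrd W 2`, `Finite (W.selmerGroupPInfty 2)`, odd torsion order} + CERT {gap, rank | layer count, `λ_an = n`}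
  ⟹ `LambdaHalfAtTwo W`; NO Greenberg 4.14, NO Kato, NO GZK.
* `…_of_irr_finiteSelmer` — on the `E[2]`-irreducible block: PRINT {`hmod`, `hAU`} + kernel {`GoodOrd W 2`, `Irr W 2`,
  `Finite (W.selmerGroupPInfty 2)`} + CERT.
* `…_of_irr_rankZero` — keyed on `W.analyticRank = 0` + `hGZK` instead (the K4 rows' currency).
* §4 `GreenbergFiniteSub.noFiniteSubmoduleAt_of_goodOrd_of_finiteSelmer` / `…_of_analyticRank_eq_zero` — the residual cell b2b's typed
  input `Rank1Residual.Additive.NoFiniteSubmoduleAt p W` (budget schema (b′)) on {`GoodOrd W p`, `Sel` finite | `r_an = 0` + GZK}, every `p`.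

References: [GreenbergLNM1716] §4 p. 104, Prop. 4.14; [GreenbergVatsal2000] p. 4; [AbbesUllmo1996] Thm. A; [Darmon2004] Thm. 3.22;
[Washington1997] §13.2.
-/

set_option autoImplicit false
-- justification: the mandated namespace `Summit.BirchSwinnertonDyer.BirchSwinnertonDyer.Theorems`
-- (single-conjunct summit, Sub = Summit) repeats a segment by design (D-0017).
set_option linter.dupNamespace false

noncomputable section

open scoped Classical MatrixGroups ModularForm

open NumberField CongruenceSubgroup WeierstrassCurve Literature.NumberTheory.EllipticCurves
  Literature.NumberTheory.EllipticCurves.ModularForms Literature.NumberTheory.EllipticCurves.Rank1Residual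
  Literature.NumberTheory.EllipticCurves.Rank1Residual.Typed
  Literature.NumberTheory.EllipticCurves.Greenberg1999
  Summit.BirchSwinnertonDyer.Rank1Residual.X1.MuLambda
  Summit.BirchSwinnertonDyer.Rank1Residual.X1.ParitySqueeze
  Summit.BirchSwinnertonDyer.BirchSwinnertonDyer.Theorems.Rank1ResidualX1Defs
  Summit.BirchSwinnertonDyer.Rank1Residual.X5 Summit.BirchSwinnertonDyer.Rank1Residual.X5.O1
  Summit.BirchSwinnertonDyer.Rank1Residual.X5.TowerGap Summit.BirchSwinnertonDyer.Rank1Residual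
  Summit.BirchSwinnertonDyer.BirchSwinnertonDyer.Theorems

namespace Summit.BirchSwinnertonDyer.BirchSwinnertonDyer.Theorems.TwoAdicTwistConverse

variable (W : WeierstrassCurve ℚ) [W.IsElliptic] [W.IsGloballyMinimal]

/-! ## §1 Odd torsion order + `Sel_{2^∞}(E/ℚ)` finite: `h414` struck, nothing printed in its place -/

/-- **Door (TOWER currency `2^n ≤ #X/(2,T^j)X`), `Sel`-finite form, WITHOUT `h414`.** PRINT {`hmod`}; DISPLAYED `hper₀`; kernel
{`GoodOrd W 2`, `Finite (W.selmerGroupPInfty 2)`, `2 ∤ #E(ℚ)_tors`}; CERT {`TowerGapAtTwo W`, `∃ j, 2^n ≤ #X/(2,T^j)X` at every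
cyclotomic datum, `λ_an = n`} ⟹ `LambdaHalfAtTwo W`. The no-finite-submodule input is the kernel theorem
`GreenbergFiniteSub.forall_finite_eq_bot_of_goodOrd_of_noPTorsion` ((Sel_∞)_γ = 0 ⇒ Nakayama) instead of Greenberg Prop. 4.14@2.
[cite: GreenbergLNM1716, §4 p. 104, Prop. 4.14] [cite: GreenbergVatsal2000, p. 4 (after Thm. (1.2))] [cite: Washington1997, §13.2] -/
theorem lambdaHalfAtTwo_of_towerGap_of_towerRank_of_finiteSelmer (hmod : nonempty_modularParametrizationData)
    (hper₀ : ∀ [NeZero (W.conductorNorm ℤ)] (f : CuspForm (Gamma0 (W.conductorNorm ℤ)) 2),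
      IsNewformOf W f → ∀ ϖ : ℚ, (ϖ : ℝ) * W.realPeriodRat = plusPeriod f → 0 ≤ padicValRat 2 ϖ)
    (hgo : GoodOrd W 2) [Finite (W.selmerGroupPInfty 2)] (htors : ¬ 2 ∣ W.torsionOrder) (hgap : TowerGapAtTwo W) {n : ℕ}
    (hrank : ∀ (κ : ZpExtension ℚ 2) (γ : Field.absoluteGaloisGroup ℚ), κ.IsCyclotomic →
      κ.IsTopGenerator γ → IsCyclotomicVariable 2 γ → ∀ D : W.SelmerDualData κ γ,
      ∃ j : ℕ, 2 ^ n ≤ Nat.card (D.X ⧸ (towerIdeal 2 j • ⊤ : Submodule (IwasawaAlgebra 2) D.X)))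
    (hlan : AnalyticLambdaEq W 2 n) : LambdaHalfAtTwo W :=
  -- (`convert` bridges the two `DecidableEq ℚ` instances behind the group law on `W.toAffine.Point`)
  lambdaHalfAtTwo_of_lambda_le W hmod hper₀ hlan
    (KatoHalfPinch.le_lambda_of_towerGap_of_towerRank_of_finiteSelmer W hgo
      (fun P hP ↦ Iwasawa.forall_smul_eq_zero_imp_of_not_dvd_torsionOrder W htors P (by convert hP)) hgap hrank)

/-- **Door (LAYER currency `2^n ≤ #Sel_{2^∞}(E/ℚ_j)[2]`), `Sel`-finite form, WITHOUT `h414`.** PRINT {`hmod`}; DISPLAYED `hper₀`;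
kernel {`GoodOrd W 2`, `Finite (W.selmerGroupPInfty 2)`, `2 ∤ #E(ℚ)_tors`}; CERT {`TowerGapAtTwo W`, `2^n ≤ #Sel_{2^∞}(E/ℚ_j)[2]`
for every cyclotomic `κ`, `λ_an = n`} ⟹ `LambdaHalfAtTwo W`. [cite: GreenbergLNM1716, §1 p. 60, §3 pp. 85–86, §4 p. 104]
[cite: GreenbergVatsal2000, p. 4 (after Thm. (1.2))] -/
theorem lambdaHalfAtTwo_of_towerGap_of_layerSelmer_of_finiteSelmer (hmod : nonempty_modularParametrizationData)
    (hper₀ : ∀ [NeZero (W.conductorNorm ℤ)] (f : CuspForm (Gamma0 (W.conductorNorm ℤ)) 2),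
      IsNewformOf W f → ∀ ϖ : ℚ, (ϖ : ℝ) * W.realPeriodRat = plusPeriod f → 0 ≤ padicValRat 2 ϖ)
    (hgo : GoodOrd W 2) [Finite (W.selmerGroupPInfty 2)] (htors : ¬ 2 ∣ W.torsionOrder) (hgap : TowerGapAtTwo W) {j n : ℕ}
    (hsel : ∀ κ : ZpExtension ℚ 2, κ.IsCyclotomic →
      2 ^ n ≤ Nat.card {z : W.selmerLayer κ j // 2 • z = 0})
    (hlan : AnalyticLambdaEq W 2 n) : LambdaHalfAtTwo W :=
  lambdaHalfAtTwo_of_towerGap_of_towerRank_of_finiteSelmer W hmod hper₀ hgo htors hgap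
    (KatoHalfPinch.towerRank_of_layerSelmerTwoTorsion W htors hsel) hlan

/-! ## §2 The `E[2]`-irreducible block (`Irr W 2` ⇒ odd torsion; `hper₀` from Abbes–Ullmo) -/

/-- **Door (TOWER currency) on the `E[2]`-IRREDUCIBLE block, `Sel`-finite form, WITHOUT `h414`**: PRINT {`hmod`, `hAU`} + kernel
{`GoodOrd W 2`, `Irr W 2`, `Finite (W.selmerGroupPInfty 2)`} + CERT {gap, `hrank`, `λ_an = n`} ⟹ `LambdaHalfAtTwo W`.
[cite: AbbesUllmo1996, Thm. A] [cite: GreenbergLNM1716, §4 p. 104, Prop. 4.14] -/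
theorem lambdaHalfAtTwo_of_towerGap_of_towerRank_of_irr_finiteSelmer (hmod : nonempty_modularParametrizationData)
    (hAU : abbesUllmo_not_dvd_maninConstant_of_not_dvd_level) (hgo : GoodOrd W 2) (hirr : Irr W 2)
    [Finite (W.selmerGroupPInfty 2)] (hgap : TowerGapAtTwo W) {n : ℕ}
    (hrank : ∀ (κ : ZpExtension ℚ 2) (γ : Field.absoluteGaloisGroup ℚ), κ.IsCyclotomic →
      κ.IsTopGenerator γ → IsCyclotomicVariable 2 γ → ∀ D : W.SelmerDualData κ γ,
      ∃ j : ℕ, 2 ^ n ≤ Nat.card (D.X ⧸ (towerIdeal 2 j • ⊤ : Submodule (IwasawaAlgebra 2) D.X)))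
    (hlan : AnalyticLambdaEq W 2 n) : LambdaHalfAtTwo W :=
  lambdaHalfAtTwo_of_towerGap_of_towerRank_of_finiteSelmer W hmod
    (TowerClass.periodRatio_nonneg_of_irr_two_of_abbesUllmo W hAU hgo hirr) hgo
    (TowerClass.not_two_dvd_torsionOrder_of_irr W hirr) hgap hrank hlan

/-- **Door (LAYER currency) on the `E[2]`-IRREDUCIBLE block, `Sel`-finite form, WITHOUT `h414`**: PRINT {`hmod`, `hAU`} + kernel
{`GoodOrd W 2`, `Irr W 2`, `Finite (W.selmerGroupPInfty 2)`} + CERT {gap, `hsel`, `λ_an = n`} ⟹ `LambdaHalfAtTwo W`.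
[cite: AbbesUllmo1996, Thm. A] [cite: GreenbergLNM1716, §3 pp. 85–86, §4 p. 104, Prop. 4.14] -/
theorem lambdaHalfAtTwo_of_towerGap_of_layerSelmer_of_irr_finiteSelmer (hmod : nonempty_modularParametrizationData)
    (hAU : abbesUllmo_not_dvd_maninConstant_of_not_dvd_level) (hgo : GoodOrd W 2) (hirr : Irr W 2)
    [Finite (W.selmerGroupPInfty 2)] (hgap : TowerGapAtTwo W) {j n : ℕ}
    (hsel : ∀ κ : ZpExtension ℚ 2, κ.IsCyclotomic →
      2 ^ n ≤ Nat.card {z : W.selmerLayer κ j // 2 • z = 0})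
    (hlan : AnalyticLambdaEq W 2 n) : LambdaHalfAtTwo W :=
  lambdaHalfAtTwo_of_towerGap_of_layerSelmer_of_finiteSelmer W hmod
    (TowerClass.periodRatio_nonneg_of_irr_two_of_abbesUllmo W hAU hgo hirr) hgo
    (TowerClass.not_two_dvd_torsionOrder_of_irr W hirr) hgap hsel hlan

/-! ## §3 The K4 rows' currency: `W.analyticRank = 0` + GZK -/

/-- **Door (TOWER currency) on the `E[2]`-IRREDUCIBLE block at analytic rank `0`, WITHOUT `h414`**: PRINT {`hmod`, `hGZK`, `hAU`} +
kernel {`GoodOrd W 2`, `Irr W 2`, `W.analyticRank = 0`} + CERT {gap, `hrank`, `λ_an = n`} ⟹ `LambdaHalfAtTwo W`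
(`Sel_{2^∞}(E/ℚ)` finite by GZK). [cite: AbbesUllmo1996, Thm. A] [cite: GreenbergLNM1716, §4 p. 104, Prop. 4.14] [cite: Darmon2004, Thm. 3.22] -/
theorem lambdaHalfAtTwo_of_towerGap_of_towerRank_of_irr_rankZero (hmod : nonempty_modularParametrizationData)
    (hGZK : rank_eq_analyticRank_of_analyticRank_le_one) (hAU : abbesUllmo_not_dvd_maninConstant_of_not_dvd_level)
    (hgo : GoodOrd W 2) (hirr : Irr W 2) (hr : W.analyticRank = 0) (hgap : TowerGapAtTwo W) {n : ℕ}
    (hrank : ∀ (κ : ZpExtension ℚ 2) (γ : Field.absoluteGaloisGroup ℚ), κ.IsCyclotomic →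
      κ.IsTopGenerator γ → IsCyclotomicVariable 2 γ → ∀ D : W.SelmerDualData κ γ,
      ∃ j : ℕ, 2 ^ n ≤ Nat.card (D.X ⧸ (towerIdeal 2 j • ⊤ : Submodule (IwasawaAlgebra 2) D.X)))
    (hlan : AnalyticLambdaEq W 2 n) : LambdaHalfAtTwo W :=
  haveI : Fact (Nat.Prime 2) := ⟨Nat.prime_two⟩
  haveI := finite_selmerGroupPInfty_of_analyticRank_eq_zero hGZK W 2 hr
  lambdaHalfAtTwo_of_towerGap_of_towerRank_of_irr_finiteSelmer W hmod hAU hgo hirr hgap hrank hlan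

/-- **Door (LAYER currency) on the `E[2]`-IRREDUCIBLE block at analytic rank `0`, WITHOUT `h414`**: PRINT {`hmod`, `hGZK`, `hAU`} +
kernel {`GoodOrd W 2`, `Irr W 2`, `W.analyticRank = 0`} + CERT {gap, `hsel`, `λ_an = n`} ⟹ `LambdaHalfAtTwo W`.
[cite: AbbesUllmo1996, Thm. A] [cite: GreenbergLNM1716, §3 pp. 85–86, §4 p. 104, Prop. 4.14] [cite: Darmon2004, Thm. 3.22] -/
theorem lambdaHalfAtTwo_of_towerGap_of_layerSelmer_of_irr_rankZero (hmod : nonempty_modularParametrizationData)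
    (hGZK : rank_eq_analyticRank_of_analyticRank_le_one) (hAU : abbesUllmo_not_dvd_maninConstant_of_not_dvd_level)
    (hgo : GoodOrd W 2) (hirr : Irr W 2) (hr : W.analyticRank = 0) (hgap : TowerGapAtTwo W) {j n : ℕ}
    (hsel : ∀ κ : ZpExtension ℚ 2, κ.IsCyclotomic →
      2 ^ n ≤ Nat.card {z : W.selmerLayer κ j // 2 • z = 0})
    (hlan : AnalyticLambdaEq W 2 n) : LambdaHalfAtTwo W :=
  haveI : Fact (Nat.Prime 2) := ⟨Nat.prime_two⟩
  haveI := finite_selmerGroupPInfty_of_analyticRank_eq_zero hGZK W 2 hr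
  lambdaHalfAtTwo_of_towerGap_of_layerSelmer_of_irr_finiteSelmer W hmod hAU hgo hirr hgap hsel hlan

end Summit.BirchSwinnertonDyer.BirchSwinnertonDyer.Theorems.TwoAdicTwistConverse

/-! ## §4 The b2b typed input `Rank1Residual.Additive.NoFiniteSubmoduleAt p W` on {`GoodOrd W p`, `Sel_{p^∞}(E/ℚ)` finite} -/

namespace Summit.BirchSwinnertonDyer.BirchSwinnertonDyer.Theorems.GreenbergFiniteSub

/-- **The residual cell's typed input `NoFiniteSubmoduleAt p W` (n1011 budget schema, discharged there BY NAME from Prop. 4.14) is a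
KERNEL theorem on {`GoodOrd W p`, `Sel_{p^∞}(E/ℚ)` finite, `p ∤ #E(ℚ)_tors`}** — every prime `p`; the extra binders of the predicate
(`IsCyclotomicVariable`, `Module.Finite`, `D.IsTorsion`) are not used. [cite: GreenbergLNM1716, §4 p. 104, Prop. 4.14]
[cite: HachimoriMatsuno2000, Cor. (i)] -/
theorem noFiniteSubmoduleAt_of_goodOrd_of_finiteSelmer (W : WeierstrassCurve ℚ) [W.IsElliptic] [W.IsGloballyMinimal] {p : ℕ}
    [Fact p.Prime] (hgo : GoodOrd W p) [Finite (W.selmerGroupPInfty p)] (htors : ¬ p ∣ W.torsionOrder) :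
    Summit.BirchSwinnertonDyer.Rank1Residual.Additive.NoFiniteSubmoduleAt p W :=
  fun {κ} {_} hκ hγ _ D _ _ N hN ↦ forall_finite_eq_bot_of_goodOrd_of_not_dvd_torsionOrder W hgo κ hκ hγ htors D N hN

/-- **The same at analytic rank `0`** (`Sel_{p^∞}(E/ℚ)` finite by GZK): PRINT {`hGZK`} + kernel {`GoodOrd W p`, `W.analyticRank = 0`,
`p ∤ #E(ℚ)_tors`} ⟹ `NoFiniteSubmoduleAt p W`. [cite: GreenbergLNM1716, §4 p. 104, Prop. 4.14] [cite: Darmon2004, Thm. 3.22] -/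
theorem noFiniteSubmoduleAt_of_goodOrd_of_analyticRank_eq_zero (W : WeierstrassCurve ℚ) [W.IsElliptic] [W.IsGloballyMinimal]
    {p : ℕ} [Fact p.Prime] (hGZK : rank_eq_analyticRank_of_analyticRank_le_one) (hgo : GoodOrd W p) (hr : W.analyticRank = 0)
    (htors : ¬ p ∣ W.torsionOrder) : Summit.BirchSwinnertonDyer.Rank1Residual.Additive.NoFiniteSubmoduleAt p W :=
  haveI := finite_selmerGroupPInfty_of_analyticRank_eq_zero hGZK W p hr
  noFiniteSubmoduleAt_of_goodOrd_of_finiteSelmer W hgo htors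

end Summit.BirchSwinnertonDyer.BirchSwinnertonDyer.Theorems.GreenbergFiniteSub

end
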